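import Mathlib
import HarnessLib
import Literature.Analysis.FluidPDE.SuitableWeak
import Literature.Analysis.FluidPDE.WeakSolution
import Literature.Analysis.FluidPDE.TypeIAncientMild
import Literature.Analysis.FluidPDE.LocalTypeI
import Summits.NavierStokesRegularity.NavierStokesRegularity.Theorems.TypeIQuarterGateScarZoomDefs
import Summits.NavierStokesRegularity.NavierStokesRegularity.Theorems.TypeIQuarterGateSliceBudgetDefs

/-!
# Route `TypeIQuarterGate` — objects posited by LINE `slice_budget`, VERSION 7, of crux
  `ScarEnvelopeTypeI` (item stmt-NavierStokesRegularity-23843): the `H¹` seam of the deciding stub SD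

Definitions ONLY — the seven propositions / sets of version 7 of the line file
`Cruxes/ScarEnvelopeTypeI/Lines/slice_budget_v7.lean` (line owner ns-idea-7 g3, tree timestamp
2026-08-28T09:12Z, filed FILES-ONLY per KEY-NS #108 (3); structural input = LEAD lineage ns-sz-p1 g4
08:58:03Z: the provable seam of SD is «`H¹`-FAT concentration» vs «`H¹`-NULL DUST»), copied VERBATIM
(the line's local notation `E3` spelled out as `EuclideanSpace ℝ (Fin 3)`) into an importable module in
the line's own namespace `…Cruxes.ScarEnvelopeTypeI.SliceBudget`, so that the two new stubs

* `stub_fatKill  : FatKill`  (SF — every Albritton–Barker-class object has `H¹`-null final-time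
  singular set; PROVABLE: CKN at the top time under the Morrey bound, by-name helper files
  `Theorems/TypeIQuarterGateScarEnvelopeTypeITopEpsilonRegularity.lean`, `…TopTimeCKN.lean`),
* `stub_dustKill : DustKill` (SK — DECIDING: SD for blow-ups all of whose scar zoom limits carry only
  `H¹`-null final-time singularity; the residual «dust» enemy)

can be proved in separate `Theorems/` files against ONE tree declaration each and a later version of the
line can import them by name (precedents on the same crux: `TypeIQuarterGateScarZoomDefs` p606736,
`TypeIQuarterGateSliceBudgetDefs` p612755).  The glue `SD_of : FatKill → DustKill → SD` is the line's.

* `SD` — the statement of the registered deciding stub `stub_sliceOctaveBudget` (v1–v6) as a named Prop;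
* `ABClass M U P H` — the Albritton–Barker class in which the tree's scar zooms land (the first five
  conjuncts of the conclusion of `exists_typeIAncientMild_twinZoomLimit_budget`, p614802): KNSS-gauge
  Type-I ancient mild; suitable weak in every backward ball at the top vertex; suitable weak on the
  open past slab with a weak spatial gradient; `𝐈((−∞,0) × ℝ³) < ⊤`;
* `finalSingularSet U` — the points `x` with `(0, x)` a backward singular point;
* `IsZoomLimitAt T u a U` — `U` is a pointwise zoom limit of `u` at `(T, a)` (scales `λₙ → 0`,
  centres `xₙ → a`, vertex times `tₙ ≤ T` with `(T − tₙ)/λₙ² → 0`);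
* `FinalDustOnly T u a` — every A–B-class zoom limit of `u` at `(T, a)` has `H¹`-null final-time
  singular set;
* `FatKill`, `DustKill` — the two stub statements.

HONEST FRAMING: nothing is asserted here (definitions only); the crux `ScarEnvelopeTypeI`, its parent
`QuarterLawTypeI` and the summit are OPEN; no statement about them is proved by this file.
-/

noncomputable section

-- the summit-side namespace `Summit.NavierStokesRegularity.NavierStokesRegularity.…` (single-conjunct
-- summit, D-0017) repeats a component by design; the dupNamespace linter would flag every declaration.
set_option linter.dupNamespace false

namespace Summit.NavierStokesRegularity.NavierStokesRegularity.Cruxes.ScarEnvelopeTypeI.SliceBudget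

open MeasureTheory Set Filter Topology
open scoped ENNReal
open Literature.Analysis Literature.Analysis.FluidPDE
open Summit.NavierStokesRegularity.NavierStokesRegularity.Cruxes.ScarEnvelopeTypeI.ScarZoom
  (CruxHypotheses TameOutside)

/-- SD AS A NAMED PROP (v7): token-identical to the statement of v1–v6's registered deciding stub
`stub_sliceOctaveBudget` — the slice-wise octave budget under the crux hypotheses and tameness.
Verbatim from the line file `Cruxes/ScarEnvelopeTypeI/Lines/slice_budget_v7.lean`. -/
def SD : Prop :=
    ∀ (ν T : ℝ) (u : ℝ → EuclideanSpace ℝ (Fin 3) → EuclideanSpace ℝ (Fin 3))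
      (p : ℝ → EuclideanSpace ℝ (Fin 3) → ℝ),
      CruxHypotheses ν T u p → TameOutside T u → OctaveBudget ν T u

/-- THE ALBRITTON–BARKER CLASS in which the tree's scar zooms land — verbatim the first five
conjuncts of the conclusion of the landed `exists_typeIAncientMild_twinZoomLimit_budget` (p614802):
KNSS-gauge Type-I ancient mild with constant `M`; suitable weak (Lin / A–B Def. 2.1) in EVERY backward
parabolic ball `Q_{R'}(0,0)` at the top vertex; suitable weak on the open past slab; a weak spatial
gradient `H` there; A–B's scale-invariant Type-I quantity `𝐈((−∞,0) × ℝ³) < ⊤` (the Morrey bound at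
all points and scales).  Verbatim from the line file (v7). [cite: AlbrittonBarker2019, §1, Def. 2.1] -/
def ABClass (M : ℝ) (U : ℝ → EuclideanSpace ℝ (Fin 3) → EuclideanSpace ℝ (Fin 3))
    (P : ℝ → EuclideanSpace ℝ (Fin 3) → ℝ)
    (H : ℝ → EuclideanSpace ℝ (Fin 3) → EuclideanSpace ℝ (Fin 3) →L[ℝ] EuclideanSpace ℝ (Fin 3)) :
    Prop :=
  IsTypeIAncientMild M U ∧
    (∀ R' : ℝ, 0 < R' →
      IsSuitableWeakSolutionInBall R' ((0 : ℝ), (0 : EuclideanSpace ℝ (Fin 3))) U P) ∧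
    IsSuitableWeakSolutionOn (slab (EuclideanSpace ℝ (Fin 3)) (Iio 0) isOpen_Iio) 1 0 U P ∧
    HasWeakSpatialGradientOn (slab (EuclideanSpace ℝ (Fin 3)) (Iio 0) isOpen_Iio) U H ∧
    typeIBound (Iio (0 : ℝ) ×ˢ univ) U P H < ⊤

/-- THE FINAL-TIME SINGULAR SET of an ancient object: the points `x` such that `(0, x)` is a backward
singular point (`U ∉ L^∞(Q_r(0,x))` for every `r > 0`, A–B §1).  Verbatim from the line file (v7). -/
def finalSingularSet (U : ℝ → EuclideanSpace ℝ (Fin 3) → EuclideanSpace ℝ (Fin 3)) :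
    Set (EuclideanSpace ℝ (Fin 3)) :=
  {x | IsBackwardSingularPoint U ((0 : ℝ), x)}

/-- `U` IS A ZOOM LIMIT OF `u` AT `(T, a)`: along some scales `λₙ → 0⁺`, centres `xₙ → a` and vertex
times `tₙ ≤ T` with `(T − tₙ)/λₙ² → 0`, the Navier–Stokes rescalings `λₙ u(tₙ + λₙ² s, xₙ + λₙ y)`
converge to `U(s, y)` POINTWISE on the open past `s < 0` (the weakest convergence, so that «all zoom
limits» is the largest family; subsequences are absorbed by re-indexing).  Verbatim from the line
file (v7). -/
def IsZoomLimitAt (T : ℝ) (u : ℝ → EuclideanSpace ℝ (Fin 3) → EuclideanSpace ℝ (Fin 3))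
    (a : EuclideanSpace ℝ (Fin 3)) (U : ℝ → EuclideanSpace ℝ (Fin 3) → EuclideanSpace ℝ (Fin 3)) :
    Prop :=
  ∃ (lam : ℕ → ℝ) (xc : ℕ → EuclideanSpace ℝ (Fin 3)) (tc : ℕ → ℝ),
    (∀ n, 0 < lam n) ∧ Tendsto lam atTop (𝓝 0) ∧ Tendsto xc atTop (𝓝 a) ∧ (∀ n, tc n ≤ T) ∧
    Tendsto (fun n => (T - tc n) / lam n ^ 2) atTop (𝓝 0) ∧
    ∀ s : ℝ, s < 0 → ∀ y : EuclideanSpace ℝ (Fin 3),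
      Tendsto (fun n => lam n • u (tc n + lam n ^ 2 * s) (xc n + lam n • y)) atTop (𝓝 (U s y))

/-- ONLY DUST AT `(T, a)`: every A–B-class zoom limit of `u` at `(T, a)` has `H¹`-null final-time
singular set.  Verbatim from the line file (v7). -/
def FinalDustOnly (T : ℝ) (u : ℝ → EuclideanSpace ℝ (Fin 3) → EuclideanSpace ℝ (Fin 3))
    (a : EuclideanSpace ℝ (Fin 3)) : Prop :=
  ∀ (M : ℝ) (U : ℝ → EuclideanSpace ℝ (Fin 3) → EuclideanSpace ℝ (Fin 3))
    (P : ℝ → EuclideanSpace ℝ (Fin 3) → ℝ)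
    (H : ℝ → EuclideanSpace ℝ (Fin 3) → EuclideanSpace ℝ (Fin 3) →L[ℝ] EuclideanSpace ℝ (Fin 3)),
    ABClass M U P H → IsZoomLimitAt T u a U → μH[1] (finalSingularSet U) = 0

/-- SF — THE `H¹`-FAT KILL (class form): every object of the A–B class has `H¹`-null final-time
singular set.  CKN 1982 at the top time under the Morrey bound; no Liouville theorem involved.  Verbatim
from the line file (v7); this is the statement of the stub `stub_fatKill`. -/
def FatKill : Prop :=
  ∀ (M : ℝ) (U : ℝ → EuclideanSpace ℝ (Fin 3) → EuclideanSpace ℝ (Fin 3))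
    (P : ℝ → EuclideanSpace ℝ (Fin 3) → ℝ)
    (H : ℝ → EuclideanSpace ℝ (Fin 3) → EuclideanSpace ℝ (Fin 3) →L[ℝ] EuclideanSpace ℝ (Fin 3)),
    ABClass M U P H → μH[1] (finalSingularSet U) = 0

/-- SK — THE DUST KILL (deciding): the slice-wise octave budget for crux-class blow-ups all of whose
A–B-class zoom limits, at every point, carry only `H¹`-null final-time singular sets.  SD with the fat
scenarios removed; strictly below SD.  Verbatim from the line file (v7); this is the statement of the
stub `stub_dustKill`. -/
def DustKill : Prop :=
  ∀ (ν T : ℝ) (u : ℝ → EuclideanSpace ℝ (Fin 3) → EuclideanSpace ℝ (Fin 3))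
    (p : ℝ → EuclideanSpace ℝ (Fin 3) → ℝ),
    CruxHypotheses ν T u p → TameOutside T u →
      (∀ a : EuclideanSpace ℝ (Fin 3), FinalDustOnly T u a) → OctaveBudget ν T u

end Summit.NavierStokesRegularity.NavierStokesRegularity.Cruxes.ScarEnvelopeTypeI.SliceBudget

end
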